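import Literature.MathematicalPhysics.QuantumFieldTheory.Balaban1983to89.Beta.RemainderLocality

/-!
# Beta / RemainderExplicitGaugeNull — BINDER-OWNERS row D4, ROAD P3 (co-owner #3, unit `b2b-balaban-beta-d4-p3`),
# skeleton leaf E1′: LINEARISED-GAUGE DIRECTIONS ARE HESSIAN-NULL AT A CRITICAL POINT OF AN INVARIANT ANALYTIC FUNCTION,
# so the (4.3)/(4.35) second variation does not see which gauge representative of the linearised minimiser is used

HONEST FRAMING (page 1 of everything the β sub-cell writes): discharging `BetaPertH` makes Bałaban's UV stability
UNCONDITIONAL — a real constructive-QFT result; it is NOT the continuum limit and NOT the Clay problem.  HONEST DEPENDENCY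
(verbatim): «continuum YM on T⁴ ⇐ BetaPertH ∧ nine spine estimates (0/9 proved); BetaPertH ⇐ (D1) ∧ (D4) ∧ CAP+tail;
G-an2-4 gates asym, D1 and NE2/3/4.»  THIS MODULE IS `[folklore]` CALCULUS in a complex normed space (Mathlib's Fréchet
derivative, the symmetry of second derivatives over `ℂ`, and the cell's `B12Decay510.mixedDeriv` /
`RemainderLocality.mixedDeriv_eq_fderiv_fderiv`); it asserts nothing about Bałaban's papers and instantiates no binder.

ABSOLUTE RULE (cell charter, verbatim): "No internally-minted statement may enter as a cited fact. Every hypothesis is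
either kernel-proved in this package or a verbatim quotation of a PUBLISHED theorem with page reference. The manuscript(s)
under audit are NOT citable for their own disputed steps — they are the thing under adjudication; programme-internal
(2001/route/tribunal) claims are never citable."  Nothing is cited here; the `[cite: …]`-free docstrings name the printed
CONTEXT only.

## Why road P3 wants this (skeleton `HOME/beta/skeletons/D4-b2b-balaban-beta-d4-p3.md` §3 leaf E1′)

[Balaban1987RG1] p. 281 (4.2)–(4.3): the B-derivatives of `𝐄^{(j)}(X, U_j(□₀, exp iB))` at `B = 0` are derivatives of the
gauge-invariant ((4.2), (4.7) p. 282) analytic function `𝐀 ↦ 𝐄^{(j)}(X, exp iξ𝐀)` ALONG the derivatives at zero of the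
□₀-ADAPTED minimiser `𝐇_j(□₀, ·)` ((3.37) p. 277: an axial-type gauge representative centred at `□₀`); p. 284 (4.14): the first
derivative of that function at `𝐀 = 0` VANISHES (gauge invariance + semisimplicity; kernel mechanism `B12Decay510R1` (4)–(5)).
Road P3 reads the test configurations as the columns of the TYPED `U = 1` KKT solution operator `Beta.KernelSpecInstance.wH`
(a Landau-type gauge representative).  Two gauge representatives of the SAME linearised minimiser differ by a linearised
gauge direction `v = ξ(0)` (the s-derivative at `s = 0` of a one-parameter family of gauge transformations `g s` through the
identity).  This file proves, abstractly: if `E ∘ g s = E` near `0`, `g 0 = id`, and `DE(0) = 0`, then every such `v` is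
NULL for the second derivative `D²E(0)` in BOTH slots (`hessian_null_right/left`), hence
`mixedDeriv E (a + v) (b + v') = mixedDeriv E a b` for null `v, v'` (`mixedDeriv_add_null`) — the (4.35) second variation
is the same for either representative.  So the residual clause (R.e) of `RemainderExplicitRoad.Residual.hrepr` may be read
with the tree's representative at no cost.  Bookkeeping-grade; NOT summit progress.
-/

namespace Summit.QuantumFields.BalabanUV.Beta.RemainderExplicitGaugeNull

open Literature.MathematicalPhysics.QuantumFieldTheory.Balaban1983to89
open B12Decay510 (mixedDeriv)
open Beta.RemainderLocality (mixedDeriv_eq_fderiv_fderiv differentiableAt_fderiv_of_analyticAt)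
open Filter Topology

noncomputable section

variable {W : Type*} [NormedAddCommGroup W] [NormedSpace ℂ W]

/-! ## §1 Null directions of the Hessian from an infinitesimal invariance `DE(w)[ξ(w)] = 0` near `0` -/

/-- **A direction field annihilated by `DE` near `0` is Hessian-null at a critical point (second slot).**  If
`w ↦ DE(w)[ξ(w)]` vanishes on a neighbourhood of `0`, `DE` is differentiable at `0`, `ξ` is differentiable at `0` and
`DE(0) = 0`, then `D²E(0)[h][ξ(0)] = 0` for every `h` (product rule for the evaluation `(DE(w))(ξ(w))`: its derivative at
`0` is `h ↦ D²E(0)[h][ξ(0)] + DE(0)[Dξ(0)h]`, and it is `0` because the function is locally `0`). [folklore] -/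
theorem hessian_null_right {E : W → ℂ} {ξ : W → W} (hE2 : DifferentiableAt ℂ (fderiv ℂ E) 0)
    (h0 : fderiv ℂ E 0 = 0) (hξ : DifferentiableAt ℂ ξ 0) (hinv : ∀ᶠ w in 𝓝 (0 : W), fderiv ℂ E w (ξ w) = 0) (h : W) :
    fderiv ℂ (fderiv ℂ E) 0 h (ξ 0) = 0 := by
  -- the evaluation map φ w = (DE w) (ξ w) and its derivative at 0
  have hφ : HasFDerivAt (fun w => (fderiv ℂ E w) (ξ w))
      ((fderiv ℂ E 0).comp (fderiv ℂ ξ 0) + (fderiv ℂ (fderiv ℂ E) 0).flip (ξ 0)) 0 :=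
    hE2.hasFDerivAt.clm_apply hξ.hasFDerivAt
  -- φ is locally zero, so its derivative is zero
  have hφ0 : HasFDerivAt (fun w => (fderiv ℂ E w) (ξ w)) (0 : W →L[ℂ] ℂ) 0 := by
    have hc : HasFDerivAt (fun _ : W => (0 : ℂ)) (0 : W →L[ℂ] ℂ) 0 := hasFDerivAt_const 0 0
    exact hc.congr_of_eventuallyEq (hinv.mono fun w hw => hw)
  have heq := hφ.unique hφ0
  rw [h0, ContinuousLinearMap.zero_comp, zero_add] at heq
  have := congrArg (fun L : W →L[ℂ] ℂ => L h) heq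
  simpa using this

/-- **Symmetric form (first slot)** for `E` analytic at `0`: `D²E(0)[ξ(0)][h] = 0` (symmetry of the second derivative
over `ℂ`, Mathlib `second_derivative_symmetric_of_eventually`). [folklore] -/
theorem hessian_null_left {E : W → ℂ} {ξ : W → W} (hE : AnalyticAt ℂ E 0) (h0 : fderiv ℂ E 0 = 0)
    (hξ : DifferentiableAt ℂ ξ 0) (hinv : ∀ᶠ w in 𝓝 (0 : W), fderiv ℂ E w (ξ w) = 0) (h : W) :
    fderiv ℂ (fderiv ℂ E) 0 (ξ 0) h = 0 := by
  have hE2 : DifferentiableAt ℂ (fderiv ℂ E) 0 := differentiableAt_fderiv_of_analyticAt hE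
  have hf : ∀ᶠ y in 𝓝 (0 : W), HasFDerivAt E (fderiv ℂ E y) y := by
    filter_upwards [hE.eventually_analyticAt] with y hy using hy.differentiableAt.hasFDerivAt
  rw [second_derivative_symmetric_of_eventually hf hE2.hasFDerivAt (ξ 0) h]
  exact hessian_null_right hE2 h0 hξ hinv h

/-! ## §2 The (4.3) mixed derivative ignores null shifts in both slots -/

/-- A **Hessian-null vector** of `E` at `0`: null in both slots of `D²E(0)`. [folklore] -/
def IsHessianNull (E : W → ℂ) (v : W) : Prop :=
  (∀ h, fderiv ℂ (fderiv ℂ E) 0 h v = 0) ∧ ∀ h, fderiv ℂ (fderiv ℂ E) 0 v h = 0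

/-- The value at `0` of a direction field annihilated by `DE` near `0` is Hessian-null (for `E` analytic at `0` with
`DE(0) = 0`). [folklore] -/
theorem isHessianNull_of_inv {E : W → ℂ} {ξ : W → W} (hE : AnalyticAt ℂ E 0) (h0 : fderiv ℂ E 0 = 0)
    (hξ : DifferentiableAt ℂ ξ 0) (hinv : ∀ᶠ w in 𝓝 (0 : W), fderiv ℂ E w (ξ w) = 0) : IsHessianNull E (ξ 0) :=
  ⟨hessian_null_right (differentiableAt_fderiv_of_analyticAt hE) h0 hξ hinv, hessian_null_left hE h0 hξ hinv⟩

/-- `0` is Hessian-null. [folklore] -/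
theorem isHessianNull_zero (E : W → ℂ) : IsHessianNull E 0 :=
  ⟨fun h => by simp, fun h => by simp⟩

/-- Hessian-null vectors form a subspace: closed under addition. [folklore] -/
theorem IsHessianNull.add {E : W → ℂ} {v v' : W} (hv : IsHessianNull E v) (hv' : IsHessianNull E v') :
    IsHessianNull E (v + v') :=
  ⟨fun h => by rw [map_add, hv.1 h, hv'.1 h, add_zero], fun h => by
    simp only [map_add, FunLike.coe_add, Pi.add_apply, hv.2 h, hv'.2 h, add_zero]⟩

/-- Hessian-null vectors form a subspace: closed under scalars. [folklore] -/
theorem IsHessianNull.smul {E : W → ℂ} {v : W} (hv : IsHessianNull E v) (c : ℂ) : IsHessianNull E (c • v) :=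
  ⟨fun h => by rw [map_smul, hv.1 h, smul_zero], fun h => by
    simp only [map_smul, FunLike.coe_smul, Pi.smul_apply, hv.2 h, smul_zero]⟩

/-- **THE (4.3)/(4.35) SECOND VARIATION IGNORES HESSIAN-NULL SHIFTS OF BOTH TEST CONFIGURATIONS**:
`mixedDeriv E (a + v) (b + v') = mixedDeriv E a b` for `E` with `DE` differentiable at `0` and `v, v'` Hessian-null.
[folklore] -/
theorem mixedDeriv_add_null {E : W → ℂ} (hE2 : DifferentiableAt ℂ (fderiv ℂ E) 0) {a b v v' : W}
    (hv : IsHessianNull E v) (hv' : IsHessianNull E v') : mixedDeriv E (a + v) (b + v') = mixedDeriv E a b := by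
  rw [mixedDeriv_eq_fderiv_fderiv hE2, mixedDeriv_eq_fderiv_fderiv hE2]
  simp only [map_add, FunLike.coe_add, Pi.add_apply, hv.1, hv'.2, add_zero]

/-- The same with the shift in the first slot only. [folklore] -/
theorem mixedDeriv_add_null_left {E : W → ℂ} (hE2 : DifferentiableAt ℂ (fderiv ℂ E) 0) {a b v : W}
    (hv : IsHessianNull E v) : mixedDeriv E (a + v) b = mixedDeriv E a b := by
  simpa using mixedDeriv_add_null hE2 (a := a) (b := b) hv (isHessianNull_zero E)

/-- The same with the shift in the second slot only. [folklore] -/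
theorem mixedDeriv_add_null_right {E : W → ℂ} (hE2 : DifferentiableAt ℂ (fderiv ℂ E) 0) {a b v' : W}
    (hv' : IsHessianNull E v') : mixedDeriv E a (b + v') = mixedDeriv E a b := by
  simpa using mixedDeriv_add_null hE2 (a := a) (b := b) (isHessianNull_zero E) hv'

/-! ## §3 From an invariance FAMILY through the identity to the infinitesimal invariance of §1 -/

/-- **Invariance under a one-parameter family through the identity kills `DE` on the generator.**  Let `g : ℂ → W → W`
with `g 0 w = w`, `s ↦ g s w` differentiable at `s = 0` with derivative `ξ w`, and `E (g s w) = E w` for `(s, w)` near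
`(0, 0)`; if `E` is differentiable near `0` then `DE(w)[ξ(w)] = 0` for `w` near `0` (the s-derivative at `0` of the
locally constant function `s ↦ E (g s w)` computed by the chain rule). [folklore] -/
theorem fderiv_apply_generator_eq_zero {E : W → ℂ} {g : ℂ → W → W} {ξ : W → W}
    (hE : ∀ᶠ w in 𝓝 (0 : W), DifferentiableAt ℂ E w) (hg0 : ∀ w, g 0 w = w)
    (hg : ∀ᶠ w in 𝓝 (0 : W), HasDerivAt (fun s => g s w) (ξ w) 0)
    (hinv : ∀ᶠ p in 𝓝 ((0 : ℂ), (0 : W)), E (g p.1 p.2) = E p.2) :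
    ∀ᶠ w in 𝓝 (0 : W), fderiv ℂ E w (ξ w) = 0 := by
  -- unpack the product neighbourhood into an s-neighbourhood and a w-neighbourhood
  obtain ⟨U, hU, V, hV, hUV⟩ := Filter.mem_prod_iff.mp (nhds_prod_eq (x := (0 : ℂ)) (y := (0 : W)) ▸ hinv)
  filter_upwards [hE, hg, hV] with w hEw hgw hwV
  -- s ↦ E (g s w) is eventually constant (= E w) near s = 0
  have hconst : (fun s : ℂ => E (g s w)) =ᶠ[𝓝 0] fun _ => E w := by
    filter_upwards [hU] with s hs
    exact hUV (Set.mk_mem_prod hs hwV)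
  have hd0 : HasDerivAt (fun s : ℂ => E (g s w)) 0 0 :=
    (hasDerivAt_const (0 : ℂ) (E w)).congr_of_eventuallyEq hconst
  -- chain rule: the same derivative is DE(g 0 w)[ξ w] = DE(w)[ξ w]
  have hEw' : DifferentiableAt ℂ E (g 0 w) := by rw [hg0]; exact hEw
  have hchain : HasDerivAt (fun s : ℂ => E (g s w)) (fderiv ℂ E (g 0 w) (ξ w)) 0 :=
    hEw'.hasFDerivAt.comp_hasDerivAt (0 : ℂ) hgw
  have := hchain.unique hd0
  rwa [hg0] at this

/-- **ROAD P3, leaf E1′, assembled**: for `E` analytic at `0` with `DE(0) = 0` and invariant under a one-parameter family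
`g` through the identity with generator field `ξ` (differentiable at `0`), the generator `ξ 0` at the origin is
Hessian-null; hence (`mixedDeriv_add_null`) the (4.35) second variation is the same along `h` and along `h + ξ 0`.  For
Bałaban's `𝐄^{(j)}(X, exp iξ𝐀)` this is the statement that the □₀-adapted (axial) and the Landau-type representatives of
the linearised `U = 1` minimiser give the same polarization term; here it is pure calculus, the invariance being a
HYPOTHESIS. [folklore] -/
theorem isHessianNull_generator {E : W → ℂ} {g : ℂ → W → W} {ξ : W → W} (hE : AnalyticAt ℂ E 0)
    (h0 : fderiv ℂ E 0 = 0) (hg0 : ∀ w, g 0 w = w) (hg : ∀ᶠ w in 𝓝 (0 : W), HasDerivAt (fun s => g s w) (ξ w) 0)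
    (hξ : DifferentiableAt ℂ ξ 0) (hinv : ∀ᶠ p in 𝓝 ((0 : ℂ), (0 : W)), E (g p.1 p.2) = E p.2) :
    IsHessianNull E (ξ 0) :=
  isHessianNull_of_inv hE h0 hξ
    (fderiv_apply_generator_eq_zero (hE.eventually_analyticAt.mono fun _ hw => hw.differentiableAt) hg0 hg hinv)

/-- **Corollary in the shape road P3 consumes**: two pairs of test configurations differing by generators of invariance
families give the same (4.3) mixed derivative. [folklore] -/
theorem mixedDeriv_eq_of_generators {E : W → ℂ} (hE : AnalyticAt ℂ E 0) (h0 : fderiv ℂ E 0 = 0)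
    {g₁ g₂ : ℂ → W → W} {ξ₁ ξ₂ : W → W} (hg₁0 : ∀ w, g₁ 0 w = w) (hg₂0 : ∀ w, g₂ 0 w = w)
    (hg₁ : ∀ᶠ w in 𝓝 (0 : W), HasDerivAt (fun s => g₁ s w) (ξ₁ w) 0)
    (hg₂ : ∀ᶠ w in 𝓝 (0 : W), HasDerivAt (fun s => g₂ s w) (ξ₂ w) 0)
    (hξ₁ : DifferentiableAt ℂ ξ₁ 0) (hξ₂ : DifferentiableAt ℂ ξ₂ 0)
    (hinv₁ : ∀ᶠ p in 𝓝 ((0 : ℂ), (0 : W)), E (g₁ p.1 p.2) = E p.2)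
    (hinv₂ : ∀ᶠ p in 𝓝 ((0 : ℂ), (0 : W)), E (g₂ p.1 p.2) = E p.2) (a b : W) :
    mixedDeriv E (a + ξ₁ 0) (b + ξ₂ 0) = mixedDeriv E a b :=
  mixedDeriv_add_null (differentiableAt_fderiv_of_analyticAt hE) (isHessianNull_generator hE h0 hg₁0 hg₁ hξ₁ hinv₁)
    (isHessianNull_generator hE h0 hg₂0 hg₂ hξ₂ hinv₂)

end

end Summit.QuantumFields.BalabanUV.Beta.RemainderExplicitGaugeNull
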